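/-
Origin: expansion seat `prover-pub-hodgecm-mc-sinst-1-g5-0`, handover #1219 2026-08-20T09:42Z md5 66df926fc3d7 (268 l., 24 decls) NEW additive drop-alone leaf over vendored W2 files only (no rowdep); (VT) W4: Levi point-transformation operator `Φ ↦ Φ ∘ P⁻¹` on 𝓢(D, ℂ) EXACTLY rhoSD-covariant over (p,q) ↦ (a p, (a⁻¹)ᵀ q), a = e P e⁻¹; for a Levi-shaped g ∈ Sp(W_𝔸) (archAct g (a,w) = (P a, Q w)) archPhaseMap T e hT g = that map, hence `compCLM_symm_covariant_archPhaseMap` in the hA shape of arch_implements_of_covariant_rhoSD_clm; NAME LIST: HodgeCM.Model.ArchLevi.compCLM_symm_covariant_archPhaseMap · HodgeCM.Model.ArchLevi.archPhaseMap_of_levi · HodgeCM.Model.ArchLevi.compCLM_symm_rhoSD (`HOME/mc/pub-hodgecm-mc-sinst-1-g5/stage/HodgeCM/Model/ArchLeviTransport.lean`, md5 66df926fc3d7, 268 lines);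
landed by the gen-18 packager (p-g18) in gate run 47 as `HodgeCM/Model/ArchLeviTransport.lean` (verbatim).
-/
/-
Origin: speedrun cell pub-hodgecm, MODEL-CONSTRUCTION sub-cell, lineage mc-sinst-1 (S-instance constructor, BINDER-OWNERS row 5 `S` / row 6 `μ`: (J-μ) slots 2/3,
(VT) item W4 of `mc/pub-hodgecm-mc-period-1-g14/notes/STRIP-SCOPE.g14.md`), seat prover-pub-hodgecm-mc-sinst-1-g5-0 (gen 5), 2026-08-20.
Target in PKG: `HodgeCM/Model/ArchLeviTransport.lean` (NEW additive leaf; imports only the vendored W2 files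
`Weil1964/ArchFollandCocycleOne` (archPhaseMap / rhoSD dictionary) and `SegalBargmann/SchwartzMetaplecticGenerators` (`rhoMul_levi`); no rowdep).
KERNEL only: 0 records / `def … : Prop` / cites-as-hypotheses, 0 proof holes; intended closure {propext, Classical.choice, Quot.sound}.
-/
import Literature.NumberTheory.Weil1964.ArchFollandCocycleOne
import Literature.Analysis.SegalBargmann.SchwartzMetaplecticGenerators
import Mathlib.LinearAlgebra.Matrix.DotProduct
import Mathlib.Topology.Algebra.Module.FiniteDimension

/-!
# Levi (point-transformation) operators on `𝓢(D)`: exact Heisenberg covariance, and the archimedean phase map of a Levi element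

(VT) item W4 of period-1-g14's scoping note for the (J-μ) slots 2/3 junction (#1217 / #1218): the MODEL OPERATOR of a
real Levi element is composition with a real linear automorphism of the Schrödinger Lagrangian, and it is EXACTLY
`rhoSD`-covariant — no scalar — over the linear phase-space map `(p, q) ↦ (a p, a^∨ q)`, `a^∨ = (a⁻¹)ᵀ`.

* §1 (generic real carrier `D`, frame `e : D ≃L[ℝ] ℝ^σ`).  `leviContra a = (a⁻¹)ᵀ` (`dotProduct_leviContra : a x · a^∨ y = x · y`),
  `frameLevi e P = e ∘ P ∘ e⁻¹`, and **`compCLM_rhoSD_of_dual`** / **`compCLM_symm_rhoSD`**: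
  `(Φ ↦ Φ ∘ P⁻¹) (rhoSD e p q Φ) = rhoSD e (a p) (a^∨ q) ((Φ ↦ Φ ∘ P⁻¹) Φ)` with `a = frameLevi e P`
  — Folland's `μ(m_a) Φ = |det a|^{-1/2} Φ ∘ a⁻¹` ([Folland1989, (4.24)]) without the (covariance-irrelevant) modulus factor,
  transported to `𝓢(D)` along `e` (`SegalBargmann.rhoSD`, [Folland1989, (1.25)]); `leviPhaseMap a d (p, q) = (a p, d q)` and the
  composition rule `covariant_comp_compCLM` (an operator exactly covariant over `γ`, precomposed with the Levi operator, is
  exactly covariant over `γ ∘ leviPhaseMap`).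
* §2 (the cell's archimedean dictionary, `Weil1964.archPhaseMap`).  If `g ∈ Sp(W_𝔸)` acts on archimedean pairs in LEVI SHAPE,
  `archAct T g (a, w) = (P a, Q w)`, then symplecticity forces the trace duality
  `⟨P u, T_∞ Q w⟩_{Tr} = ⟨u, T_∞ w⟩_{Tr}` (`piTracePairing_archAct_levi`), hence
  **`archPhaseMap_of_levi`**: `archPhaseMap T e hT g (p, q) = (frameLevi e P p, leviContra (frameLevi e P) q)`, and
  **`compCLM_symm_covariant_archPhaseMap`**: `Φ ↦ Φ ∘ P⁻¹` is EXACTLY `rhoSD`-covariant over `archPhaseMap T e hT g` — literally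
  the `hA` hypothesis shape of `ArchFollandCocycleOne.arch_implements_of_covariant_rhoSD_clm` and of the W5 continuous-Schur step.

Consumers: period-1's (VT) (`m̃ = toSp(1,k)⁻¹ h₀` is Levi with `P⁻¹ = 1_V ⊗ M` = theta-3's (K9) `conjFrameTransport`); nothing here
is specific to the see-saw datum.  Nothing is a claim of PerL/QW8; nothing is cited as a fact.

References: [Folland1989] G. B. Folland, *Harmonic Analysis in Phase Space*, Princeton UP 1989, (1.25), Prop. (1.43), (4.24).
-/

set_option autoImplicit false

noncomputable section

open scoped Matrix SchwartzMap Classical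
open Complex NumberField NumberField.mixedEmbedding IsDedekindDomain
open Literature.NumberTheory.Automorphic Literature.RepresentationTheory.HeisenbergGroup
open Literature.Analysis.SegalBargmann Literature.NumberTheory.Weil1964

namespace HodgeCM.Model.ArchLevi

/-! ## §1 Levi operators on `𝓢(D)` and their exact Heisenberg covariance -/

section Generic

variable {σ : Type*} [Fintype σ] [DecidableEq σ]
variable {D : Type*} [NormedAddCommGroup D] [NormedSpace ℝ D]

/-- The matrix of `a⁻¹`, for a real linear automorphism `a` of `ℝ^σ`. [folklore] -/
abbrev invMat (a : (σ → ℝ) ≃ₗ[ℝ] (σ → ℝ)) : Matrix σ σ ℝ := LinearMap.toMatrix' (a.symm : (σ → ℝ) →ₗ[ℝ] (σ → ℝ))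

/-- The matrix of `a`. [folklore] -/
abbrev mat (a : (σ → ℝ) ≃ₗ[ℝ] (σ → ℝ)) : Matrix σ σ ℝ := LinearMap.toMatrix' (a : (σ → ℝ) →ₗ[ℝ] (σ → ℝ))

/-- (Ported verbatim from the HodgeCMPerL package; no docstring in the source.) -/
private theorem mat_mul_invMat (a : (σ → ℝ) ≃ₗ[ℝ] (σ → ℝ)) : mat a * invMat a = 1 := by
  rw [mat, invMat, ← LinearMap.toMatrix'_comp]
  have : (a : (σ → ℝ) →ₗ[ℝ] (σ → ℝ)) ∘ₗ (a.symm : (σ → ℝ) →ₗ[ℝ] (σ → ℝ)) = LinearMap.id := by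
    ext x
    simp
  rw [this, LinearMap.toMatrix'_id]

/-- (Ported verbatim from the HodgeCMPerL package; no docstring in the source.) -/
private theorem invMat_mul_mat (a : (σ → ℝ) ≃ₗ[ℝ] (σ → ℝ)) : invMat a * mat a = 1 := by
  rw [mat, invMat, ← LinearMap.toMatrix'_comp]
  have : (a.symm : (σ → ℝ) →ₗ[ℝ] (σ → ℝ)) ∘ₗ (a : (σ → ℝ) →ₗ[ℝ] (σ → ℝ)) = LinearMap.id := by
    ext x
    simp
  rw [this, LinearMap.toMatrix'_id]

/-- **The contragredient `a^∨ := (a⁻¹)ᵀ`** of a real linear automorphism of `ℝ^σ` (w.r.t. the dot product):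
`a^∨ q = (a⁻¹)ᵀ q = q ᵥ* [a⁻¹]`. [cite: Folland1989, (4.24)] -/
def leviContra (a : (σ → ℝ) ≃ₗ[ℝ] (σ → ℝ)) : (σ → ℝ) ≃ₗ[ℝ] (σ → ℝ) :=
  LinearEquiv.ofLinear (Matrix.toLin' (invMat a)ᵀ) (Matrix.toLin' (mat a)ᵀ)
    (by rw [← Matrix.toLin'_mul, ← Matrix.transpose_mul, mat_mul_invMat, Matrix.transpose_one, Matrix.toLin'_one])
    (by rw [← Matrix.toLin'_mul, ← Matrix.transpose_mul, invMat_mul_mat, Matrix.transpose_one, Matrix.toLin'_one])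

/-- Unfolding: `a^∨ q = q ᵥ* [a⁻¹]`. [folklore] -/
theorem leviContra_apply (a : (σ → ℝ) ≃ₗ[ℝ] (σ → ℝ)) (q : σ → ℝ) : leviContra a q = q ᵥ* invMat a := by
  rw [leviContra, LinearEquiv.ofLinear_apply, Matrix.toLin'_apply, Matrix.mulVec_transpose]

/-- **Duality**: `a x · a^∨ y = x · y`. [cite: Folland1989, (4.24)] -/
theorem dotProduct_leviContra (a : (σ → ℝ) ≃ₗ[ℝ] (σ → ℝ)) (x y : σ → ℝ) : a x ⬝ᵥ leviContra a y = x ⬝ᵥ y := by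
  rw [leviContra_apply, dotProduct_comm, ← Matrix.dotProduct_mulVec, invMat, LinearMap.toMatrix'_mulVec,
    LinearEquiv.coe_coe, LinearEquiv.symm_apply_apply, dotProduct_comm]

/-- The dual reading: `a^∨ y · u = y · a⁻¹ u`. [folklore] -/
theorem leviContra_dotProduct (a : (σ → ℝ) ≃ₗ[ℝ] (σ → ℝ)) (y u : σ → ℝ) : leviContra a y ⬝ᵥ u = y ⬝ᵥ a.symm u := by
  have h := dotProduct_leviContra a (a.symm u) y
  rw [LinearEquiv.apply_symm_apply] at h
  rw [dotProduct_comm, h, dotProduct_comm]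

/-- **The Levi element of a carrier automorphism `P : D ≃ D` in the frame `e`**: `frameLevi e P = e ∘ P ∘ e⁻¹ ∈ GL(ℝ^σ)`. [folklore] -/
def frameLevi (e : D ≃L[ℝ] (σ → ℝ)) (P : D ≃L[ℝ] D) : (σ → ℝ) ≃ₗ[ℝ] (σ → ℝ) :=
  ((e.symm.trans P).trans e).toLinearEquiv

omit [Fintype σ] [DecidableEq σ] in
/-- Unfolding. [folklore] -/
@[simp] theorem frameLevi_apply (e : D ≃L[ℝ] (σ → ℝ)) (P : D ≃L[ℝ] D) (x : σ → ℝ) :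
    frameLevi e P x = e (P (e.symm x)) := rfl

omit [Fintype σ] [DecidableEq σ] in
/-- Unfolding of the inverse. [folklore] -/
@[simp] theorem frameLevi_symm_apply (e : D ≃L[ℝ] (σ → ℝ)) (P : D ≃L[ℝ] D) (x : σ → ℝ) :
    (frameLevi e P).symm x = e (P.symm (e.symm x)) := rfl

/-- **The Levi phase-space map** `(p, q) ↦ (a p, d q)`. [cite: Folland1989, (4.24)] -/
def leviPhaseMap (a d : (σ → ℝ) ≃ₗ[ℝ] (σ → ℝ)) (pq : (σ → ℝ) × (σ → ℝ)) : (σ → ℝ) × (σ → ℝ) := (a pq.1, d pq.2)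

omit [Fintype σ] [DecidableEq σ] in
/-- Unfolding. [folklore] -/
@[simp] theorem leviPhaseMap_apply (a d : (σ → ℝ) ≃ₗ[ℝ] (σ → ℝ)) (p q : σ → ℝ) : leviPhaseMap a d (p, q) = (a p, d q) := rfl

omit [DecidableEq σ] in
/-- **Exact Heisenberg covariance of a point transformation, dual-pair form**: if `e ∘ J = a⁻¹ ∘ e` on `D` and
`a x · d y = x · y`, then `(Φ ↦ Φ ∘ J) ∘ rhoSD e p q = rhoSD e (a p) (d q) ∘ (Φ ↦ Φ ∘ J)` on `𝓢(D, ℂ)` — Folland's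
`μ(m_a) ρ(p, q) μ(m_a)⁻¹ = ρ(a p, a^{∨} q)` without the modulus factor. [cite: Folland1989, (4.24), (1.25)] -/
theorem compCLM_rhoSD_of_dual (e : D ≃L[ℝ] (σ → ℝ)) (J : D ≃L[ℝ] D) {a d : (σ → ℝ) ≃ₗ[ℝ] (σ → ℝ)}
    (ha : ∀ y : D, e (J y) = a.symm (e y)) (had : ∀ x y : σ → ℝ, a x ⬝ᵥ d y = x ⬝ᵥ y)
    (p q : σ → ℝ) (Φ : 𝓢(D, ℂ)) :
    SchwartzMap.compCLMOfContinuousLinearEquiv ℂ J (rhoSD e p q Φ) =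
      rhoSD e (a p) (d q) (SchwartzMap.compCLMOfContinuousLinearEquiv ℂ J Φ) := by
  ext y
  have hJ : J (e.symm (a p)) = e.symm p := by
    apply e.injective
    rw [ha, ContinuousLinearEquiv.apply_symm_apply, LinearEquiv.symm_apply_apply, ContinuousLinearEquiv.apply_symm_apply]
  rw [SchwartzMap.compCLMOfContinuousLinearEquiv_apply, Function.comp_apply, rhoSD_apply, rhoSD_apply,
    SchwartzMap.compCLMOfContinuousLinearEquiv_apply, Function.comp_apply, ha, rhoMul_levi had, J.map_add, hJ]

/-- **Exact Heisenberg covariance of `Φ ↦ Φ ∘ P⁻¹`** over `(p, q) ↦ (a p, a^∨ q)`, `a = frameLevi e P = e P e⁻¹`.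
[cite: Folland1989, (4.24), (1.25)] -/
theorem compCLM_symm_rhoSD (e : D ≃L[ℝ] (σ → ℝ)) (P : D ≃L[ℝ] D) (p q : σ → ℝ) (Φ : 𝓢(D, ℂ)) :
    SchwartzMap.compCLMOfContinuousLinearEquiv ℂ P.symm (rhoSD e p q Φ) =
      rhoSD e (frameLevi e P p) (leviContra (frameLevi e P) q) (SchwartzMap.compCLMOfContinuousLinearEquiv ℂ P.symm Φ) :=
  compCLM_rhoSD_of_dual e P.symm (fun y => by rw [frameLevi_symm_apply, ContinuousLinearEquiv.symm_apply_apply])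
    (dotProduct_leviContra (frameLevi e P)) p q Φ

/-- The same, in phase-map form (`leviPhaseMap`). [cite: Folland1989, (4.24), (1.25)] -/
theorem compCLM_symm_rhoSD_phase (e : D ≃L[ℝ] (σ → ℝ)) (P : D ≃L[ℝ] D) (p q : σ → ℝ) (Φ : 𝓢(D, ℂ)) :
    SchwartzMap.compCLMOfContinuousLinearEquiv ℂ P.symm (rhoSD e p q Φ) =
      rhoSD e (leviPhaseMap (frameLevi e P) (leviContra (frameLevi e P)) (p, q)).1
        (leviPhaseMap (frameLevi e P) (leviContra (frameLevi e P)) (p, q)).2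
        (SchwartzMap.compCLMOfContinuousLinearEquiv ℂ P.symm Φ) :=
  compCLM_symm_rhoSD e P p q Φ

omit [DecidableEq σ] in
/-- **Composition rule**: an operator `A` exactly `rhoSD`-covariant over a phase-space self-map `γ`, precomposed with an operator
`L` exactly covariant over `δ`, is exactly covariant over `γ ∘ δ`. [folklore] -/
theorem covariant_comp (e : D ≃L[ℝ] (σ → ℝ)) {γ δ : (σ → ℝ) × (σ → ℝ) → (σ → ℝ) × (σ → ℝ)}
    (A L : 𝓢(D, ℂ) →L[ℂ] 𝓢(D, ℂ))
    (hA : ∀ (p q : σ → ℝ) (Φ : 𝓢(D, ℂ)), A (rhoSD e p q Φ) = rhoSD e (γ (p, q)).1 (γ (p, q)).2 (A Φ))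
    (hL : ∀ (p q : σ → ℝ) (Φ : 𝓢(D, ℂ)), L (rhoSD e p q Φ) = rhoSD e (δ (p, q)).1 (δ (p, q)).2 (L Φ))
    (p q : σ → ℝ) (Φ : 𝓢(D, ℂ)) :
    (A.comp L) (rhoSD e p q Φ) = rhoSD e ((γ ∘ δ) (p, q)).1 ((γ ∘ δ) (p, q)).2 ((A.comp L) Φ) := by
  rw [ContinuousLinearMap.comp_apply, hL, hA, ContinuousLinearMap.comp_apply, Function.comp_apply]

/-- **Composition with a Levi operator**: `A` exactly covariant over `γ` ⇒ `A ∘ (Φ ↦ Φ ∘ P⁻¹)` exactly covariant over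
`γ ∘ leviPhaseMap (e P e⁻¹) ((e P e⁻¹)^∨)`. [cite: Folland1989, (4.24)] -/
theorem covariant_comp_compCLM (e : D ≃L[ℝ] (σ → ℝ)) {γ : (σ → ℝ) × (σ → ℝ) → (σ → ℝ) × (σ → ℝ)}
    (A : 𝓢(D, ℂ) →L[ℂ] 𝓢(D, ℂ)) (P : D ≃L[ℝ] D)
    (hA : ∀ (p q : σ → ℝ) (Φ : 𝓢(D, ℂ)), A (rhoSD e p q Φ) = rhoSD e (γ (p, q)).1 (γ (p, q)).2 (A Φ))
    (p q : σ → ℝ) (Φ : 𝓢(D, ℂ)) :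
    (A.comp (SchwartzMap.compCLMOfContinuousLinearEquiv ℂ P.symm)) (rhoSD e p q Φ) =
      rhoSD e ((γ ∘ leviPhaseMap (frameLevi e P) (leviContra (frameLevi e P))) (p, q)).1
        ((γ ∘ leviPhaseMap (frameLevi e P) (leviContra (frameLevi e P))) (p, q)).2
        ((A.comp (SchwartzMap.compCLMOfContinuousLinearEquiv ℂ P.symm)) Φ) :=
  covariant_comp e A _ hA (compCLM_symm_rhoSD_phase e P) p q Φ

end Generic

/-! ## §2 The archimedean phase map of a Levi-shaped `g ∈ Sp(W_𝔸)` -/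

section Arch

variable {F : Type} [Field F] [NumberField F] {ι : Type} [Fintype ι] [DecidableEq ι]
variable (T : Matrix ι ι (AdeleRing (𝓞 F) F))

omit [Fintype ι] [DecidableEq ι] in
/-- `archVec 0 = 0`. [folklore] -/
theorem archVec_zero : archVec F ι (0 : ι → mixedSpace F) = 0 := by
  have h := archVec_add (F := F) (ι := ι) 0 0
  rw [add_zero] at h
  exact left_eq_add.mp h

omit [Fintype ι] [DecidableEq ι] in
/-- `infiniteAdeleInl` is injective (`y ↦ (y, 0)`). [folklore] -/
theorem infiniteAdeleInl_injective : Function.Injective (infiniteAdeleInl F) := fun x y h => by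
  have := congrArg Prod.fst h
  rwa [infiniteAdeleInl_apply, infiniteAdeleInl_apply] at this

/-- **Trace duality forced by symplecticity**: if `g ∈ Sp(W_𝔸)` acts on archimedean pairs in Levi shape,
`archAct T g (a, w) = (P a, Q w)`, then `⟨P u, T_∞ Q w⟩_{Tr} = ⟨u, T_∞ w⟩_{Tr}`. [cite: Folland1989, Prop. (4.6)] -/
theorem piTracePairing_archAct_levi (g : symplecticGroup (polar (adelicForm F ι T)))
    (P : (ι → mixedSpace F) ≃L[ℝ] (ι → mixedSpace F)) (Q : (ι → mixedSpace F) → (ι → mixedSpace F))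
    (hP : ∀ a w, (archAct T g (a, w)).1 = P a) (hQ : ∀ a w, (archAct T g (a, w)).2 = Q w)
    (u w : ι → mixedSpace F) :
    piTracePairing F ι (P u) (archMat F ι T *ᵥ Q w) = piTracePairing F ι u (archMat F ι T *ᵥ w) := by
  have hg := (mem_symplecticGroup (polar (adelicForm F ι T)) g.1).1 g.2
    (archVec F ι u, archVec F ι 0) (archVec F ι 0, archVec F ι w)
  rw [apply_archVec_pair T g u 0, apply_archVec_pair T g 0 w] at hg
  have h1 : archAct T g (u, 0) = (P u, Q 0) := Prod.ext (hP u 0) (hQ u 0)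
  have h2 : archAct T g (0, w) = (0, Q w) := Prod.ext ((hP 0 w).trans (map_zero P)) (hQ 0 w)
  rw [h1, h2] at hg
  simp only [polar_apply, adelicForm_apply, archVec_zero, zero_dotProduct, sub_zero] at hg
  rw [mulVec_archVec, mulVec_archVec, archVec_dotProduct_archVec, archVec_dotProduct_archVec] at hg
  have h3 := (InfiniteAdeleRing.ringEquiv_mixedSpace F).symm.injective (infiniteAdeleInl_injective hg)
  have h4 := congrArg (mixedTrace F) h3
  rw [map_sum, map_sum, ← piTracePairing_apply, ← piTracePairing_apply] at h4
  exact h4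

/-- **The archimedean phase map of a Levi-shaped element is the Levi phase map**:
`archPhaseMap T e hT g (p, q) = (a p, a^∨ q)` with `a = frameLevi e P = e P e⁻¹`. [cite: Folland1989, Prop. (4.6), (4.24)] -/
theorem archPhaseMap_of_levi {σ : Type*} [Fintype σ] [DecidableEq σ] (e : (ι → mixedSpace F) ≃L[ℝ] (σ → ℝ))
    (hT : IsUnit (archMat F ι T)) (g : symplecticGroup (polar (adelicForm F ι T)))
    (P : (ι → mixedSpace F) ≃L[ℝ] (ι → mixedSpace F)) (Q : (ι → mixedSpace F) → (ι → mixedSpace F))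
    (hP : ∀ a w, (archAct T g (a, w)).1 = P a) (hQ : ∀ a w, (archAct T g (a, w)).2 = Q w)
    (pq : (σ → ℝ) × (σ → ℝ)) :
    archPhaseMap T e hT g pq = leviPhaseMap (frameLevi e P) (leviContra (frameLevi e P)) pq := by
  obtain ⟨⟨a, w⟩, rfl⟩ := (archFolland_bijective T e hT).2 pq
  rw [archPhaseMap_archFolland, show archAct T g (a, w) = (P a, Q w) from Prod.ext (hP a w) (hQ a w)]
  refine Prod.ext ?_ ?_
  · rw [archFolland_fst, leviPhaseMap, archFolland_fst, frameLevi_apply, ContinuousLinearEquiv.symm_apply_apply]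
  · rw [archFolland_snd, leviPhaseMap, archFolland_snd]
    refine dotProduct_eq _ _ fun x => ?_
    obtain ⟨u, rfl⟩ := e.surjective x
    rw [follandFreq_dotProduct_apply, leviContra_dotProduct, frameLevi_symm_apply, ContinuousLinearEquiv.symm_apply_apply,
      follandFreq_dotProduct_apply, ← piTracePairing_archAct_levi T g P Q hP hQ (P.symm u) w,
      ContinuousLinearEquiv.apply_symm_apply]

/-- **W4 — the Levi model operator is EXACTLY `rhoSD`-covariant over the archimedean phase map**: for `g ∈ Sp(W_𝔸)` acting on
archimedean pairs by `(a, w) ↦ (P a, Q w)`, the point transformation `Φ ↦ Φ ∘ P⁻¹` of `𝓢((F ⊗ ℝ)^ι)` satisfies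
`L (rhoSD e p q Φ) = rhoSD e (archPhaseMap T e hT g (p, q)).1 (archPhaseMap T e hT g (p, q)).2 (L Φ)` for ALL `(p, q)` — the `hA`
shape of `ArchFollandCocycleOne.arch_implements_of_covariant_rhoSD_clm`. [cite: Folland1989, Prop. (1.43), (4.24)] -/
theorem compCLM_symm_covariant_archPhaseMap {σ : Type*} [Fintype σ] [DecidableEq σ]
    (e : (ι → mixedSpace F) ≃L[ℝ] (σ → ℝ)) (hT : IsUnit (archMat F ι T)) (g : symplecticGroup (polar (adelicForm F ι T)))
    (P : (ι → mixedSpace F) ≃L[ℝ] (ι → mixedSpace F)) (Q : (ι → mixedSpace F) → (ι → mixedSpace F))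
    (hP : ∀ a w, (archAct T g (a, w)).1 = P a) (hQ : ∀ a w, (archAct T g (a, w)).2 = Q w)
    (p q : σ → ℝ) (Φ : 𝓢((ι → mixedSpace F), ℂ)) :
    SchwartzMap.compCLMOfContinuousLinearEquiv ℂ P.symm (rhoSD e p q Φ) =
      rhoSD e (archPhaseMap T e hT g (p, q)).1 (archPhaseMap T e hT g (p, q)).2
        (SchwartzMap.compCLMOfContinuousLinearEquiv ℂ P.symm Φ) := by
  rw [archPhaseMap_of_levi T e hT g P Q hP hQ]
  exact compCLM_symm_rhoSD e P p q Φ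

/-- **… hence it implements `g` on the archimedean modulated translations up to Weil's phase** (`arch_implements_of_covariant_rhoSD_clm`).
[cite: Folland1989, Prop. (1.43)] -/
theorem compCLM_symm_archModTrans {σ : Type*} [Fintype σ] [DecidableEq σ]
    (e : (ι → mixedSpace F) ≃L[ℝ] (σ → ℝ)) (hT : IsUnit (archMat F ι T)) (g : symplecticGroup (polar (adelicForm F ι T)))
    (P : (ι → mixedSpace F) ≃L[ℝ] (ι → mixedSpace F)) (Q : (ι → mixedSpace F) → (ι → mixedSpace F))
    (hP : ∀ a w, (archAct T g (a, w)).1 = P a) (hQ : ∀ a w, (archAct T g (a, w)).2 = Q w)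
    (a w : ι → mixedSpace F) (Φ : 𝓢((ι → mixedSpace F), ℂ)) :
    SchwartzMap.compCLMOfContinuousLinearEquiv ℂ P.symm (archModTrans F ι T a w Φ) =
      weilPhase T g (a, w) • archModTrans F ι T (archAct T g (a, w)).1 (archAct T g (a, w)).2
        (SchwartzMap.compCLMOfContinuousLinearEquiv ℂ P.symm Φ) :=
  arch_implements_of_covariant_rhoSD_clm T e hT g _ (compCLM_symm_covariant_archPhaseMap T e hT g P Q hP hQ) a w Φ

end Arch

end HodgeCM.Model.ArchLevi

end
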